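import Literature.Dynamics.NBody.JensenLeykin2025

/-!
# Sanity lemmas for `IsTorusDistanceData` (pub-smale6 REVIEW-RUNBOOK, card `IsTorusDistanceData`)

Review evidence only (ops-runbook sanity registry `registry/pub-smale6.json`); no new definitions.
`IsTorusDistanceData r := (∀ i j, r i j = r j i) ∧ (∀ i, r i i = 0) ∧ (∀ i j, i ≠ j → r i j ≠ 0)`
(`Literature/Dynamics/NBody/JensenLeykin2025.lean`): symmetric, zero diagonal, non-zero off the
diagonal — a point of the torus `(K^*)^{n(n−1)/2}`, with NO metric condition.

* holds: the equilateral data (all mutual distances `1`, three bodies); the data `(1, 1, 3)` — which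
  violates the triangle inequality, so the torus relaxation is strictly larger than the set of
  geometric configurations (the point of the algebraic finiteness method); vacuously, any `1`-body data;
* fails: data with a vanishing mutual distance (`r₀₁ = 0`, a collision); non-symmetric data.
-/

namespace Summit.Ventures.CentralConfigurations.Runbook

open Literature.Dynamics.NBody

/-- The equilateral three-body data: all mutual distances `1`. -/
theorem isTorusDistanceData_equilateral :
    IsTorusDistanceData (fun i j : Fin 3 => if i = j then (0 : ℚ) else 1) := by
  unfold IsTorusDistanceData
  decide

/-- Holds-instance WITHOUT a Euclidean realisation: mutual "distances" `r₀₁ = r₀₂ = 1`, `r₁₂ = 3`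
violate the triangle inequality but are torus distance data — the predicate imposes no metric
condition (the relaxation of [JensenLeykin2025, §2.1] / Albouy–Kaloshin). -/
theorem isTorusDistanceData_nonmetric :
    IsTorusDistanceData (n := 3) (K := ℚ) ![![0, 1, 1], ![1, 0, 3], ![1, 3, 0]] := by
  unfold IsTorusDistanceData
  decide

/-- Vacuous holds-instance: one body, `r₀₀ = 0`. -/
theorem isTorusDistanceData_one_body : IsTorusDistanceData (fun _ _ : Fin 1 => (0 : ℚ)) := by
  unfold IsTorusDistanceData
  decide

/-- Fails-instance: a collision (`r₀₁ = 0`) is not torus distance data. -/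
theorem not_isTorusDistanceData_collision : ¬ IsTorusDistanceData (fun _ _ : Fin 2 => (0 : ℚ)) := by
  unfold IsTorusDistanceData
  decide

/-- Fails-instance: non-symmetric data (`r₀₁ = 1`, `r₁₀ = 2`) is not torus distance data. -/
theorem not_isTorusDistanceData_asymm :
    ¬ IsTorusDistanceData (n := 2) (K := ℚ) ![![0, 1], ![2, 0]] := by
  unfold IsTorusDistanceData
  decide

/-- What the predicate says for two bodies: exactly one non-zero symmetric mutual distance. -/
theorem isTorusDistanceData_two_iff (r : Fin 2 → Fin 2 → ℚ) :
    IsTorusDistanceData r ↔ r 0 0 = 0 ∧ r 1 1 = 0 ∧ r 0 1 = r 1 0 ∧ r 0 1 ≠ 0 := by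
  unfold IsTorusDistanceData
  constructor
  · rintro ⟨hs, hd, hz⟩
    exact ⟨hd 0, hd 1, hs 0 1, hz 0 1 (by decide)⟩
  · rintro ⟨h00, h11, h01, hz⟩
    refine ⟨?_, ?_, ?_⟩
    · intro i j
      fin_cases i <;> fin_cases j <;> simp [h01]
    · intro i
      fin_cases i <;> assumption
    · intro i j hij
      fin_cases i <;> fin_cases j
      · exact absurd rfl hij
      · exact hz
      · simpa [← h01] using hz
      · exact absurd rfl hij

end Summit.Ventures.CentralConfigurations.Runbook
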